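import Summits.CriticalPhenomena.PercolationContinuityZ3.Theses.PercNonProliferation
import Summits.CriticalPhenomena.PercolationContinuityZ3.Theses.PercHyperscalingGluing
import Summits.CriticalPhenomena.PercolationContinuityZ3.Theses.PercHollowCells
import Literature.Barriers.CriticalPhenomena.KozmaNachmiasLemma11Steps

/-!
# `FreeBoxSparse` (crux stmt-CriticalPhenomena-4445) ⇔ the centred `FreeBoxShattering` items
# (stmt-CriticalPhenomena-4644 of route PercHyperscalingGluing, stmt-CriticalPhenomena-5836 of route
# PercHollowCells): one statement, three names

Negative-side bookkeeping (cdisprove, refuter-cdisprove-stmt-CriticalPhenomena-4445-0), all PROVED.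
With `FA₂(p,n) := |B(n)|⁻² Σ_{x,y∈B(n)} P_p(x ↔ y in B(n))` (pair form, stmt-4445) and
`F(p,r) := |B(r)|⁻¹ Σ_{x∈B(r)} P_p(0 ↔ x in B(r)) = E_p|C_{B(r)}(0)| / |B(r)|` (centred form):

* `card_mul_centredSum_le_pairSum` — `|B(r)| Σ_{x∈B(r)} P(0 ↔ x in B(r)) ≤ Σ_{x,y∈B(2r)} P(x ↔ y in B(2r))`
  (translate the root over `B(r)`; tree: `real_openConnIn_shift_box`), so `F(r) ≤ 64 FA₂(2r)`;
* `pairSum_le_card_mul_centredSum` — `Σ_{x,y∈B(n)} P(x ↔ y in B(n)) ≤ |B(n)| Σ_{z∈B(2n)} P(0 ↔ z in B(2n))`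
  (enlarge `B(n) ⊆ x + B(2n)` and re-root at `x`), so `FA₂(n) ≤ 8 F(2n)`;
* `tendsto_centredAvg_iff_tendsto_freePairAverage` — `F(p, ·) → 0 ⇔ FA₂(p, ·) → 0` at every `p`;
* `freeBoxSparse_iff_hyperscalingGluing_freeBoxShattering`,
  `freeBoxSparse_iff_hollowCells_freeBoxShattering`,
  `hyperscalingGluing_iff_hollowCells_freeBoxShattering` — the three ledger items are equivalent:
  refuting or proving any one settles all three.
-/

namespace Summit.CriticalPhenomena.PercolationContinuityZ3.Theorems.FreeBoxSparse.Negative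

open MeasureTheory Filter Topology
open Literature.Probability.Percolation Literature.Probability.LatticeModels
open Literature.Barriers.CriticalPhenomena (real_openConnIn_shift_box mem_image_zdShiftIso_box_iff)
open Summit.CriticalPhenomena.PercolationContinuityZ3.Theses



/-! ### Box bookkeeping -/

/-- `0 < |B(n)|`. [folklore] -/
theorem card_box_pos' (n : ℕ) : (0 : ℝ) < (box 3 n).card := by
  exact_mod_cast Finset.card_pos.2 (box_nonempty 3 n)

/-- `|B(n)| = (2n+1)³`. [folklore] -/
theorem card_box_real' (n : ℕ) : ((box 3 n).card : ℝ) = (2 * n + 1) ^ 3 := by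
  rw [card_box]; push_cast; ring

/-- `|B(2n)| ≤ 8 |B(n)|`. [folklore] -/
theorem card_box_two_mul_le (n : ℕ) : ((box 3 (2 * n)).card : ℝ) ≤ 8 * (box 3 n).card := by
  rw [card_box_real', card_box_real']; push_cast
  nlinarith [sq_nonneg (n : ℝ), (Nat.cast_nonneg n : (0 : ℝ) ≤ n)]

/-- Monotonicity of `{x ↔ y in S}` in `S`. [folklore] -/
theorem openConnIn_mono'' {S S' : Set (Site 3)} (h : S ⊆ S') (x y : Site 3) :
    openConnIn S x y ⊆ openConnIn S' x y := fun _ hω =>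
  DCT16.mem_openConnIn_of_pathIn ((DCT16.pathIn_of_mem_openConnIn hω).mono h)

/-! ### Re-rooting inequalities -/

/-- `|B(r)| · E|C_{B(r)}(0)| ≤ Σ_{x,y∈B(2r)} P(x ↔ y in B(2r))`. [folklore] -/
theorem card_mul_centredSum_le_pairSum (p : unitInterval) (r : ℕ) :
    ((box 3 r).card : ℝ) * (∑ x ∈ box 3 r, (bondPercolation (zdGraph 3) p).real (openConnIn (↑(box 3 r) : Set (Site 3)) 0 x)) ≤ (∑ x ∈ box 3 (2 * r), ∑ y ∈ box 3 (2 * r), (bondPercolation (zdGraph 3) p).real (openConnIn (↑(box 3 (2 * r)) : Set (Site 3)) x y)) := by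
  have hrow : ∀ x ∈ box 3 r, (∑ x ∈ box 3 r, (bondPercolation (zdGraph 3) p).real (openConnIn (↑(box 3 r) : Set (Site 3)) 0 x)) ≤
      ∑ y ∈ box 3 (2 * r), (bondPercolation (zdGraph 3) p).real
        (openConnIn (↑(box 3 (2 * r)) : Set (Site 3)) x y) := by
    intro x hx
    have himg : (⇑(zdShiftIso x) '' (↑(box 3 r) : Set (Site 3))) ⊆ ↑(box 3 (2 * r)) := by
      intro w hw
      have hw' : w - x ∈ box 3 r := mem_image_zdShiftIso_box_iff.1 hw
      rw [Finset.mem_coe, mem_box] at *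
      intro i
      have h1 := hw' i; have h2 := hx i
      simp only [Pi.sub_apply] at h1
      constructor <;> omega
    have hinj : Set.InjOn (fun z : Site 3 => z + x) ↑(box 3 r) := fun a _ b _ h => add_right_cancel h
    have hmaps : ∀ z ∈ box 3 r, z + x ∈ box 3 (2 * r) := fun z hz =>
      Finset.mem_coe.1 (himg ⟨z, Finset.mem_coe.2 hz, by simp [zdShiftIso_apply]⟩)
    calc (∑ x ∈ box 3 r, (bondPercolation (zdGraph 3) p).real (openConnIn (↑(box 3 r) : Set (Site 3)) 0 x))
        = ∑ z ∈ box 3 r, (bondPercolation (zdGraph 3) p).real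
            (openConnIn (⇑(zdShiftIso x) '' ↑(box 3 r)) x (z + x)) :=
          Finset.sum_congr rfl fun z _ => (real_openConnIn_shift_box p x z r).symm
      _ ≤ ∑ z ∈ box 3 r, (bondPercolation (zdGraph 3) p).real
            (openConnIn (↑(box 3 (2 * r)) : Set (Site 3)) x (z + x)) :=
          Finset.sum_le_sum fun z _ => measureReal_mono (openConnIn_mono'' himg x (z + x))
      _ = ∑ y ∈ (box 3 r).image (fun z => z + x), (bondPercolation (zdGraph 3) p).real
            (openConnIn (↑(box 3 (2 * r)) : Set (Site 3)) x y) :=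
          (Finset.sum_image (f := fun y => (bondPercolation (zdGraph 3) p).real
            (openConnIn (↑(box 3 (2 * r)) : Set (Site 3)) x y)) hinj).symm
      _ ≤ _ := by
          refine Finset.sum_le_sum_of_subset_of_nonneg ?_ fun _ _ _ => measureReal_nonneg
          intro y hy
          obtain ⟨z, hz, rfl⟩ := Finset.mem_image.1 hy
          exact hmaps z hz
  calc ((box 3 r).card : ℝ) * (∑ x ∈ box 3 r, (bondPercolation (zdGraph 3) p).real (openConnIn (↑(box 3 r) : Set (Site 3)) 0 x)) = ∑ _x ∈ box 3 r, (∑ x ∈ box 3 r, (bondPercolation (zdGraph 3) p).real (openConnIn (↑(box 3 r) : Set (Site 3)) 0 x)) := by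
        rw [Finset.sum_const, nsmul_eq_mul]
    _ ≤ ∑ x ∈ box 3 r, ∑ y ∈ box 3 (2 * r), (bondPercolation (zdGraph 3) p).real
          (openConnIn (↑(box 3 (2 * r)) : Set (Site 3)) x y) := Finset.sum_le_sum hrow
    _ ≤ (∑ x ∈ box 3 (2 * r), ∑ y ∈ box 3 (2 * r), (bondPercolation (zdGraph 3) p).real (openConnIn (↑(box 3 (2 * r)) : Set (Site 3)) x y)) :=
        Finset.sum_le_sum_of_subset_of_nonneg (box_mono 3 (by omega)) fun _ _ _ =>
          Finset.sum_nonneg fun _ _ => measureReal_nonneg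

/-- `Σ_{x,y∈B(n)} P(x ↔ y in B(n)) ≤ |B(n)| · E|C_{B(2n)}(0)|`. [folklore] -/
theorem pairSum_le_card_mul_centredSum (p : unitInterval) (n : ℕ) :
    (∑ x ∈ box 3 n, ∑ y ∈ box 3 n, (bondPercolation (zdGraph 3) p).real (openConnIn (↑(box 3 n) : Set (Site 3)) x y)) ≤ ((box 3 n).card : ℝ) * (∑ x ∈ box 3 (2 * n), (bondPercolation (zdGraph 3) p).real (openConnIn (↑(box 3 (2 * n)) : Set (Site 3)) 0 x)) := by
  have hrow : ∀ x ∈ box 3 n,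
      ∑ y ∈ box 3 n, (bondPercolation (zdGraph 3) p).real (openConnIn (↑(box 3 n) : Set (Site 3)) x y) ≤
        (∑ x ∈ box 3 (2 * n), (bondPercolation (zdGraph 3) p).real (openConnIn (↑(box 3 (2 * n)) : Set (Site 3)) 0 x)) := by
    intro x hx
    have himg : (↑(box 3 n) : Set (Site 3)) ⊆ ⇑(zdShiftIso x) '' (↑(box 3 (2 * n)) : Set (Site 3)) := by
      intro w hw
      rw [mem_image_zdShiftIso_box_iff]
      rw [Finset.mem_coe, mem_box] at hw
      rw [mem_box] at hx ⊢
      intro i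
      have h1 := hw i; have h2 := hx i
      simp only [Pi.sub_apply]
      constructor <;> omega
    have hinj : Set.InjOn (fun y : Site 3 => y - x) ↑(box 3 n) := fun a _ b _ h => sub_left_injective h
    have hmaps : ∀ y ∈ box 3 n, y - x ∈ box 3 (2 * n) := fun y hy =>
      mem_image_zdShiftIso_box_iff.1 (himg (Finset.mem_coe.2 hy))
    calc ∑ y ∈ box 3 n, (bondPercolation (zdGraph 3) p).real (openConnIn (↑(box 3 n) : Set (Site 3)) x y)
        ≤ ∑ y ∈ box 3 n, (bondPercolation (zdGraph 3) p).real
            (openConnIn (⇑(zdShiftIso x) '' ↑(box 3 (2 * n))) x (y - x + x)) := by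
          refine Finset.sum_le_sum fun y _ => measureReal_mono ?_
          rw [sub_add_cancel]
          exact openConnIn_mono'' himg x y
      _ = ∑ y ∈ box 3 n, (bondPercolation (zdGraph 3) p).real
            (openConnIn (↑(box 3 (2 * n)) : Set (Site 3)) 0 (y - x)) :=
          Finset.sum_congr rfl fun y _ => real_openConnIn_shift_box p x (y - x) (2 * n)
      _ = ∑ z ∈ (box 3 n).image (fun y => y - x), (bondPercolation (zdGraph 3) p).real
            (openConnIn (↑(box 3 (2 * n)) : Set (Site 3)) 0 z) :=
          (Finset.sum_image (f := fun z => (bondPercolation (zdGraph 3) p).real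
            (openConnIn (↑(box 3 (2 * n)) : Set (Site 3)) 0 z)) hinj).symm
      _ ≤ (∑ x ∈ box 3 (2 * n), (bondPercolation (zdGraph 3) p).real (openConnIn (↑(box 3 (2 * n)) : Set (Site 3)) 0 x)) := by
          refine Finset.sum_le_sum_of_subset_of_nonneg ?_ fun _ _ _ => measureReal_nonneg
          intro z hz
          obtain ⟨y, hy, rfl⟩ := Finset.mem_image.1 hz
          exact hmaps y hy
  calc (∑ x ∈ box 3 n, ∑ y ∈ box 3 n, (bondPercolation (zdGraph 3) p).real (openConnIn (↑(box 3 n) : Set (Site 3)) x y)) ≤ ∑ _x ∈ box 3 n, (∑ x ∈ box 3 (2 * n), (bondPercolation (zdGraph 3) p).real (openConnIn (↑(box 3 (2 * n)) : Set (Site 3)) 0 x)) := Finset.sum_le_sum hrow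
    _ = ((box 3 n).card : ℝ) * (∑ x ∈ box 3 (2 * n), (bondPercolation (zdGraph 3) p).real (openConnIn (↑(box 3 (2 * n)) : Set (Site 3)) 0 x)) := by rw [Finset.sum_const, nsmul_eq_mul]

/-- `F(r) ≤ 64 FA₂(2r)`. [folklore] -/
theorem centredAvg_le_freePairAverage (p : unitInterval) (r : ℕ) :
    (∑ x ∈ box 3 r, (bondPercolation (zdGraph 3) p).real (openConnIn (↑(box 3 r) : Set (Site 3)) 0 x)) / (box 3 r).card ≤ 64 * ((∑ x ∈ box 3 (2 * r), ∑ y ∈ box 3 (2 * r), (bondPercolation (zdGraph 3) p).real (openConnIn (↑(box 3 (2 * r)) : Set (Site 3)) x y)) / ((box 3 (2 * r)).card : ℝ) ^ 2) := by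
  have hc := card_box_pos' r
  have hc2 := card_box_pos' (2 * r)
  have h1 := card_mul_centredSum_le_pairSum p r
  have h8 := card_box_two_mul_le r
  have hps : (0 : ℝ) ≤ (∑ x ∈ box 3 (2 * r), ∑ y ∈ box 3 (2 * r), (bondPercolation (zdGraph 3) p).real (openConnIn (↑(box 3 (2 * r)) : Set (Site 3)) x y)) :=
    Finset.sum_nonneg fun _ _ => Finset.sum_nonneg fun _ _ => measureReal_nonneg
  rw [div_le_iff₀ hc]
  calc (∑ x ∈ box 3 r, (bondPercolation (zdGraph 3) p).real (openConnIn (↑(box 3 r) : Set (Site 3)) 0 x)) ≤ (∑ x ∈ box 3 (2 * r), ∑ y ∈ box 3 (2 * r), (bondPercolation (zdGraph 3) p).real (openConnIn (↑(box 3 (2 * r)) : Set (Site 3)) x y)) / (box 3 r).card := by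
        rw [le_div_iff₀ hc]; linarith
    _ = (∑ x ∈ box 3 (2 * r), ∑ y ∈ box 3 (2 * r), (bondPercolation (zdGraph 3) p).real (openConnIn (↑(box 3 (2 * r)) : Set (Site 3)) x y)) / ((box 3 (2 * r)).card : ℝ) ^ 2 *
          (((box 3 (2 * r)).card : ℝ) ^ 2 / (box 3 r).card) := by
        field_simp
    _ ≤ (∑ x ∈ box 3 (2 * r), ∑ y ∈ box 3 (2 * r), (bondPercolation (zdGraph 3) p).real (openConnIn (↑(box 3 (2 * r)) : Set (Site 3)) x y)) / ((box 3 (2 * r)).card : ℝ) ^ 2 * ((8 * (box 3 r).card) ^ 2 / (box 3 r).card) := by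
        gcongr
    _ = 64 * ((∑ x ∈ box 3 (2 * r), ∑ y ∈ box 3 (2 * r), (bondPercolation (zdGraph 3) p).real (openConnIn (↑(box 3 (2 * r)) : Set (Site 3)) x y)) / ((box 3 (2 * r)).card : ℝ) ^ 2) * (box 3 r).card := by
        field_simp
        ring

/-- `FA₂(n) ≤ 8 F(2n)`. [folklore] -/
theorem freePairAverage_le_centredAvg (p : unitInterval) (n : ℕ) :
    (∑ x ∈ box 3 n, ∑ y ∈ box 3 n, (bondPercolation (zdGraph 3) p).real (openConnIn (↑(box 3 n) : Set (Site 3)) x y)) / ((box 3 n).card : ℝ) ^ 2 ≤ 8 * ((∑ x ∈ box 3 (2 * n), (bondPercolation (zdGraph 3) p).real (openConnIn (↑(box 3 (2 * n)) : Set (Site 3)) 0 x)) / (box 3 (2 * n)).card) := by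
  have hc := card_box_pos' n
  have hc2 := card_box_pos' (2 * n)
  have h1 := pairSum_le_card_mul_centredSum p n
  have h8 := card_box_two_mul_le n
  have hcs : (0 : ℝ) ≤ (∑ x ∈ box 3 (2 * n), (bondPercolation (zdGraph 3) p).real (openConnIn (↑(box 3 (2 * n)) : Set (Site 3)) 0 x)) := Finset.sum_nonneg fun _ _ => measureReal_nonneg
  rw [div_le_iff₀ (by positivity)]
  calc (∑ x ∈ box 3 n, ∑ y ∈ box 3 n, (bondPercolation (zdGraph 3) p).real (openConnIn (↑(box 3 n) : Set (Site 3)) x y)) ≤ ((box 3 n).card : ℝ) * (∑ x ∈ box 3 (2 * n), (bondPercolation (zdGraph 3) p).real (openConnIn (↑(box 3 (2 * n)) : Set (Site 3)) 0 x)) := h1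
    _ = ((∑ x ∈ box 3 (2 * n), (bondPercolation (zdGraph 3) p).real (openConnIn (↑(box 3 (2 * n)) : Set (Site 3)) 0 x)) / (box 3 (2 * n)).card) * ((box 3 (2 * n)).card * (box 3 n).card) := by
        field_simp
    _ ≤ ((∑ x ∈ box 3 (2 * n), (bondPercolation (zdGraph 3) p).real (openConnIn (↑(box 3 (2 * n)) : Set (Site 3)) 0 x)) / (box 3 (2 * n)).card) * ((8 * (box 3 n).card) * (box 3 n).card) := by
        gcongr
    _ = 8 * ((∑ x ∈ box 3 (2 * n), (bondPercolation (zdGraph 3) p).real (openConnIn (↑(box 3 (2 * n)) : Set (Site 3)) 0 x)) / (box 3 (2 * n)).card) * ((box 3 n).card : ℝ) ^ 2 := by ring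

/-- `n ↦ 2n` tends to infinity. [folklore] -/
theorem tendsto_two_mul_atTop' : Tendsto (fun n : ℕ => 2 * n) atTop atTop :=
  tendsto_atTop_mono (fun n => show id n ≤ 2 * n by simp only [id]; omega) tendsto_id

/-- **Centred form ⇔ pair form** (every `p`): `F(p, r) → 0` iff `FA₂(p, n) → 0`. [folklore] -/
theorem tendsto_centredAvg_iff_tendsto_freePairAverage (p : unitInterval) :
    Tendsto (fun r : ℕ => (∑ x ∈ box 3 r, (bondPercolation (zdGraph 3) p).real (openConnIn (↑(box 3 r) : Set (Site 3)) 0 x)) / (box 3 r).card) atTop (𝓝 0) ↔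
      Tendsto (fun n : ℕ => (∑ x ∈ box 3 n, ∑ y ∈ box 3 n, (bondPercolation (zdGraph 3) p).real (openConnIn (↑(box 3 n) : Set (Site 3)) x y)) / ((box 3 n).card : ℝ) ^ 2) atTop (𝓝 0) := by
  constructor
  · intro h
    have h2 : Tendsto (fun n : ℕ => 8 * ((∑ x ∈ box 3 (2 * n), (bondPercolation (zdGraph 3) p).real (openConnIn (↑(box 3 (2 * n)) : Set (Site 3)) 0 x)) / (box 3 (2 * n)).card)) atTop (𝓝 0) := by
      simpa using (h.comp tendsto_two_mul_atTop').const_mul 8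
    refine squeeze_zero (fun n => div_nonneg ?_ (sq_nonneg _)) (freePairAverage_le_centredAvg p) h2
    exact Finset.sum_nonneg fun _ _ => Finset.sum_nonneg fun _ _ => measureReal_nonneg
  · intro h
    have h2 : Tendsto (fun r : ℕ => 64 * ((∑ x ∈ box 3 (2 * r), ∑ y ∈ box 3 (2 * r), (bondPercolation (zdGraph 3) p).real (openConnIn (↑(box 3 (2 * r)) : Set (Site 3)) x y)) / ((box 3 (2 * r)).card : ℝ) ^ 2))
        atTop (𝓝 0) := by
      simpa using (h.comp tendsto_two_mul_atTop').const_mul 64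
    refine squeeze_zero (fun r => div_nonneg ?_ (card_box_pos' r).le) (centredAvg_le_freePairAverage p) h2
    exact Finset.sum_nonneg fun _ _ => measureReal_nonneg

/-- **`PercNonProliferation.FreeBoxSparse` (stmt-4445) ⇔ `PercHyperscalingGluing.FreeBoxShattering`
(stmt-4644).** [folklore] -/
theorem freeBoxSparse_iff_hyperscalingGluing_freeBoxShattering :
    PercNonProliferation.FreeBoxSparse ↔ PercHyperscalingGluing.FreeBoxShattering := by
  change Tendsto (fun n : ℕ => (∑ x ∈ box 3 n, ∑ y ∈ box 3 n, (bondPercolation (zdGraph 3) (criticalProbI 3)).real (openConnIn (↑(box 3 n) : Set (Site 3)) x y)) / ((box 3 n).card : ℝ) ^ 2) atTop (𝓝 0) ↔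
    Tendsto (fun r : ℕ => ((box 3 r).card : ℝ)⁻¹ * (∑ x ∈ box 3 r, (bondPercolation (zdGraph 3) (criticalProbI 3)).real (openConnIn (↑(box 3 r) : Set (Site 3)) 0 x))) atTop (𝓝 0)
  rw [← tendsto_centredAvg_iff_tendsto_freePairAverage]
  have : (fun r : ℕ => (∑ x ∈ box 3 r, (bondPercolation (zdGraph 3) (criticalProbI 3)).real (openConnIn (↑(box 3 r) : Set (Site 3)) 0 x)) / (box 3 r).card) =
      fun r : ℕ => ((box 3 r).card : ℝ)⁻¹ * (∑ x ∈ box 3 r, (bondPercolation (zdGraph 3) (criticalProbI 3)).real (openConnIn (↑(box 3 r) : Set (Site 3)) 0 x)) := by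
    funext r; rw [div_eq_inv_mul]
  rw [this]

/-- **`PercNonProliferation.FreeBoxSparse` (stmt-4445) ⇔ `PercHollowCells.FreeBoxShattering`
(stmt-5836).** [folklore] -/
theorem freeBoxSparse_iff_hollowCells_freeBoxShattering :
    PercNonProliferation.FreeBoxSparse ↔ PercHollowCells.FreeBoxShattering := by
  change Tendsto (fun n : ℕ => (∑ x ∈ box 3 n, ∑ y ∈ box 3 n, (bondPercolation (zdGraph 3) (criticalProbI 3)).real (openConnIn (↑(box 3 n) : Set (Site 3)) x y)) / ((box 3 n).card : ℝ) ^ 2) atTop (𝓝 0) ↔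
    Tendsto (fun L : ℕ => (∑ x ∈ box 3 L, (bondPercolation (zdGraph 3) (criticalProbI 3)).real (openConnIn (↑(box 3 L) : Set (Site 3)) 0 x)) / ((2 * (L : ℝ) + 1) ^ 3)) atTop (𝓝 0)
  rw [← tendsto_centredAvg_iff_tendsto_freePairAverage]
  have : (fun r : ℕ => (∑ x ∈ box 3 r, (bondPercolation (zdGraph 3) (criticalProbI 3)).real (openConnIn (↑(box 3 r) : Set (Site 3)) 0 x)) / (box 3 r).card) =
      fun L : ℕ => (∑ x ∈ box 3 L, (bondPercolation (zdGraph 3) (criticalProbI 3)).real (openConnIn (↑(box 3 L) : Set (Site 3)) 0 x)) / ((2 * (L : ℝ) + 1) ^ 3) := by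
    funext r; rw [card_box_real']
  rw [this]

/-- **`PercHyperscalingGluing.FreeBoxShattering` (stmt-4644) ⇔ `PercHollowCells.FreeBoxShattering`
(stmt-5836).** [folklore] -/
theorem hyperscalingGluing_iff_hollowCells_freeBoxShattering :
    PercHyperscalingGluing.FreeBoxShattering ↔ PercHollowCells.FreeBoxShattering :=
  freeBoxSparse_iff_hyperscalingGluing_freeBoxShattering.symm.trans
    freeBoxSparse_iff_hollowCells_freeBoxShattering

end Summit.CriticalPhenomena.PercolationContinuityZ3.Theorems.FreeBoxSparse.Negative
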